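import Summits.HodgeConjecture.CorCM.MumfordTateRankSixCMRank
import Literature.AlgebraicGeometry.Motives.HodgeLieWeightOneIdealPairSplitting
import HarnessLib

/-!
# The rung `dim MT(H¹(X)) = 7` with DECOMPOSABLE semisimple Hodge Lie algebra, I: the central idempotent and the splitting
# `X ∼ Y ⊞ Z` along a pair of commuting three-dimensional ideals `Lie Hg(H¹X) = 𝔞 ⊕ 𝔟`

COR-CM (cell `pub-hodgecm2`, seat `b27` gen 39, count-neutral lane MT-RANK-SEVEN-SPLIT; theorems only, no definition,
no named fact; UNCONDITIONAL — nothing here uses or asserts HC_CM).  Sequel of the lane MT-RANK-SIX-ISOGENY / -CMPART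
(`CorCM/MumfordTateRankSix{Center,Splitting,CMPart,CMRank}`, gen 37–38: semisimple rank ONE, `Hg = SL₂ · torus`), now for
semisimple rank TWO in its decomposable form: the Hodge Lie algebra `𝔥 = Lie Hg(H¹X)` is the sum of two rational IDEALS
`𝔞, 𝔟` of dimension `3` commuting with each other (neither inside `End_Hdg(H¹X)`; e.g. `X` with no factor of type IV,
`dim MT(H¹X) = 7` and `Lie Hg(H¹X)` not `ℚ`-simple — the sequel `CorCM/MumfordTateRankSevenSemisimple`).

The abstract structure theorem `HodgeStructure.exists_central_projector_of_ideal_pair`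
(`Motives/HodgeLieWeightOneIdealPair{,Component,Splitting}`: a rational central `ψ`-symmetric Hodge idempotent `p` with
`𝔞p = 𝔞`, `𝔟p = 0`, `1 − p ∈ ℚ·𝔟²`) is transported to `End⁰(X)` through the rational representation and read geometrically:

* §1 `finrank_hodgeLie_hodge_one_eq_of_block_ideal` — GENERIC: along a quasi-retraction `t : X → Z`, `j : Z → X` with
  `j^* t^* = M`, `t^* j^* = M − Mp` such that `W − pW ∈ 𝔟` for every `W ∈ Lie Hg(H¹X)` and `𝔟p = p𝔟 = 0` for a subspace
  `𝔟 ≤ Lie Hg(H¹X)`, the restriction `W ↦ M⁻¹ j^* W t^*` maps `𝔟` ISOMORPHICALLY and multiplicatively onto `Lie Hg(H¹Z)`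
  (`hodgeLie_hodge_one_eq_image_of_block`, gen 37); so `dim Lie Hg(H¹Z) = dim 𝔟`, and `Z` is NOT of CM type if `𝔟` is not
  commutative.
* §2 **`exists_splitting_of_ideal_pair`** — for `X` with `Lie Hg(H¹X) = 𝔞 ⊕ 𝔟` as above (then `0 < dim X`): a central
  idempotent `e ∈ End⁰(X)`, `e ∉ {0, 1}`, with `e^*𝔞 = 𝔞`, `e^*𝔟 = 0`, and a Poincaré splitting `X ∼ Y ⊞ Z`
  (`h : X → Y`, `i : Y → X`, `t : X → Z`, `j : Z → X`, `i h = M e`, `h i = M`, `t j = M`, `i ≫ t = 0`, `j ≫ h = 0`) with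
  `0 < dim Y`, `0 < dim Z`, `dim Y + dim Z = dim X`, **`dim Lie Hg(H¹Y) = dim Lie Hg(H¹Z) = 3`,
  `dim MT(H¹Y) = dim MT(H¹Z) = 4`, `Y` and `Z` NOT of CM type** — the Lie form of `Hg(X) = Hg(Y) × Hg(Z)` with both factors
  forms of `SL₂` (Moonen–Zarhin 1999 §3 (3.1), Cor. (3.7) after Imai; Hazama 1989).

The sequel `CorCM/MumfordTateRankSevenSplitIsogeny` applies the rung `dim MT ≤ 4` (gen 30) to `Y` and `Z`:
`X ∼ B₁^{a+1} × B₂^{b+1}` with `B₁ ≁ B₂` non-CM elliptic curves or quaternion surfaces.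

## References

* [MoonenZarhin1999LowDim] B. Moonen, Yu. Zarhin, *Hodge classes on abelian varieties of low dimension*, Math. Ann.
  315 (1999), §2 (`MT = 𝔾ₘ·Hg`, `End⁰(X) = End_{Hg}(H¹)`), §3 (3.1), Thm. (3.2), Cor. (3.7).
* [MumfordAV1970] D. Mumford, *Abelian Varieties* (1970), §19 Thm. 1 and proof of Cor. 2 (pp. 173–174), Thm. 3.
* [Deligne1982HodgeCycles] P. Deligne, *Hodge cycles on abelian varieties*, LNM 900 (1982), I §3 Prop. 3.4, §5 Prop. 5.1.
* [DeligneMilne1982Tannakian] P. Deligne, J. S. Milne, *Tannakian Categories*, LNM 900 (1982), II Thm. 6.20 (Riemann).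
-/

noncomputable section

open scoped TensorProduct
open CategoryTheory CategoryTheory.Limits Module

namespace Summit.HodgeConjecture.CorCM

open Literature.AlgebraicGeometry.Motives
open Literature.AlgebraicGeometry.Motives.AbelianVariety
open Literature.AlgebraicGeometry.Motives.HodgeStructure
open Literature.AlgebraicGeometry.HodgeTheory
open Literature.AlgebraicGeometry.ComplexMultiplication (bettiRep bettiRep_injective bettiRep_of
  bettiCohomology_map_add_one bettiCohomology_map_comp_hom bettiCohomology_map_nsmul_id_one bettiCohomology_map_zero_one)
open Literature.AlgebraicGeometry.Milne1999 (IsOfCMType isOfCMType_iff_of_isIsogenous)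

variable [HodgeTensorFacts.{0, 0}]

/-! ## §1 Restriction of `Lie Hg(H¹X)` to a block along an ideal -/

/-- **`dim Lie Hg(H¹Z) = dim 𝔟` and `Z` is not of CM type when `𝔟` is not commutative**, along a quasi-retraction
`t : X → Z`, `j : Z → X` with `j^* t^* = M ≠ 0`, `t^* j^* = M − M p` on `H¹`, for a subspace `𝔟 ≤ Lie Hg(H¹X)` such that
`W − pW ∈ 𝔟` for every `W ∈ Lie Hg(H¹X)` and `b p = 0 = p b` for `b ∈ 𝔟`.  PROOF: `Lie Hg(H¹Z)` is the image of
`r : W ↦ M⁻¹ j^* W t^*` (`hodgeLie_hodge_one_eq_image_of_block`); `r(pW) = 0` (`j^* p = 0`), so the image is `r(𝔟)`; on `𝔟`,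
`t^* (j^* b t^*) j^* = (M − Mp) b (M − Mp) = M² b` makes `r` injective, and `r(b₁) r(b₂) = r(b₁ b₂)` (`p b₂ = 0`); a
commutative `Lie Hg(H¹Z)` (which is what `Lie Hg(H¹Z) ⊆ End_Hdg(H¹Z)`, i.e. CM type, means) would force `[b₁, b₂] = 0`
(`[b₁, b₂] ∈ 𝔟` because `p[b₁, b₂] = 0`). [cite: MoonenZarhin1999LowDim, §2 and §3 (3.1)]
[cite: Deligne1982HodgeCycles, I §3 Prop. 3.4 and §5 Prop. 5.1] -/
theorem finrank_hodgeLie_hodge_one_eq_of_block_ideal {X Z : AbelianVariety ℂ} (hX : IsSmoothProjective X.dim X.X)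
    (hZ : IsSmoothProjective Z.dim Z.X) (t : X ⟶ Z) (j : Z ⟶ X) {M : ℕ} (hM : M ≠ 0)
    {p : Module.End ℚ (bettiCohomology X.X 1)}
    (hjt : (bettiCohomology.map j.hom.hom.hom 1).hom ∘ₗ (bettiCohomology.map t.hom.hom.hom 1).hom =
      (M : ℚ) • LinearMap.id)
    (htj : (bettiCohomology.map t.hom.hom.hom 1).hom ∘ₗ (bettiCohomology.map j.hom.hom.hom 1).hom =
      (M : ℚ) • LinearMap.id - (M : ℚ) • p)
    {𝔟 : Submodule ℚ (Module.End ℚ (bettiCohomology X.X 1))}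
    (h𝔟 : haveI := BettiUniverse.finite hX 1
      𝔟 ≤ (BettiUniverse.hodge exists_isReal_hodgeModel_holds hX 1).hodgeLie)
    (hW𝔟 : haveI := BettiUniverse.finite hX 1
      ∀ W ∈ (BettiUniverse.hodge exists_isReal_hodgeModel_holds hX 1).hodgeLie, W - p * W ∈ 𝔟)
    (hbp : ∀ b ∈ 𝔟, b * p = 0 ∧ p * b = 0) :
    haveI := BettiUniverse.finite hX 1
    haveI := BettiUniverse.finite hZ 1
    Module.finrank ℚ (BettiUniverse.hodge exists_isReal_hodgeModel_holds hZ 1).hodgeLie = Module.finrank ℚ 𝔟 ∧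
      ((∃ b₁ ∈ 𝔟, ∃ b₂ ∈ 𝔟, b₁ * b₂ ≠ b₂ * b₁) → ¬ IsOfCMType Z) := by
  haveI := BettiUniverse.finite hX 1
  haveI := BettiUniverse.finite hZ 1
  have hM' : (M : ℚ) ≠ 0 := Nat.cast_ne_zero.2 hM
  set H := BettiUniverse.hodge exists_isReal_hodgeModel_holds hX 1 with hH
  set HZ := BettiUniverse.hodge exists_isReal_hodgeModel_holds hZ 1 with hHZ
  set jH := (bettiCohomology.map j.hom.hom.hom 1).hom with hjH
  set tH := (bettiCohomology.map t.hom.hom.hom 1).hom with htH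
  -- the restriction map `r W = M⁻¹ j^* W t^*`
  let r : Module.End ℚ (bettiCohomology X.X 1) →ₗ[ℚ] Module.End ℚ (bettiCohomology Z.X 1) :=
    (M : ℚ)⁻¹ • ((LinearMap.llcomp ℚ _ _ _ jH) ∘ₗ (LinearMap.lcomp ℚ _ tH))
  have hr : ∀ W, r W = (M : ℚ)⁻¹ • (jH ∘ₗ W ∘ₗ tH) := fun W => rfl
  have hblk : ∀ W ∈ H.hodgeLie, W - p * W ∈ H.hodgeLie := fun W hW => h𝔟 (hW𝔟 W hW)
  have himg := hodgeLie_hodge_one_eq_image_of_block hX hZ t j hM hjt htj hblk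
  have hmap : HZ.hodgeLie = H.hodgeLie.map r := by
    apply SetLike.coe_injective
    rw [Submodule.map_coe, himg]
    exact Set.image_congr fun W _ => (hr W).symm
  -- `j^* p = 0`, `p t^* = 0`
  have hjp : jH ∘ₗ p = 0 := by
    have h1 : jH ∘ₗ (tH ∘ₗ jH) = (jH ∘ₗ tH) ∘ₗ jH := (LinearMap.comp_assoc _ _ _).symm
    rw [htj, hjt, LinearMap.comp_sub, LinearMap.comp_smul, LinearMap.comp_smul, LinearMap.comp_id,
      LinearMap.smul_comp, LinearMap.id_comp, sub_eq_self] at h1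
    exact (smul_eq_zero.1 h1).resolve_left hM'
  have hrp : ∀ W, r (p * W) = 0 := by
    intro W
    rw [hr, Module.End.mul_eq_comp, ← LinearMap.comp_assoc, ← LinearMap.comp_assoc W p jH, hjp, LinearMap.zero_comp,
      LinearMap.zero_comp, smul_zero]
  have hrsub : ∀ W, r (W - p * W) = r W := fun W => by rw [map_sub, hrp, sub_zero]
  -- `r(Lie Hg) = r(𝔟)`
  have hmapb : H.hodgeLie.map r = 𝔟.map r := by
    refine le_antisymm ?_ (Submodule.map_mono h𝔟)
    rintro _ ⟨W, hW, rfl⟩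
    exact ⟨W - p * W, hW𝔟 W hW, hrsub W⟩
  -- `r` is injective on `𝔟`
  have hinj : ∀ b ∈ 𝔟, r b = 0 → b = 0 := by
    intro b hb hrb
    obtain ⟨hbp0, hpb0⟩ := hbp b hb
    have h0 : jH ∘ₗ b ∘ₗ tH = 0 := by
      rw [hr] at hrb
      exact (smul_eq_zero.1 hrb).resolve_left (inv_ne_zero hM')
    have h1 : tH ∘ₗ (jH ∘ₗ b ∘ₗ tH) ∘ₗ jH = (tH ∘ₗ jH) * b * (tH ∘ₗ jH) := by
      rw [Module.End.mul_eq_comp, Module.End.mul_eq_comp]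
      simp only [LinearMap.comp_assoc]
    rw [h0, LinearMap.zero_comp, LinearMap.comp_zero, htj] at h1
    have h2 : ((M : ℚ) • LinearMap.id - (M : ℚ) • p) * b * ((M : ℚ) • LinearMap.id - (M : ℚ) • p) =
        ((M : ℚ) * M) • b := by
      rw [← Module.End.one_eq_id]
      simp only [sub_mul, mul_sub, smul_mul_assoc, mul_smul_comm, one_mul, mul_one, hpb0, hbp0, smul_zero, sub_zero,
        smul_smul]
    rw [h2] at h1
    exact (smul_eq_zero.1 h1.symm).resolve_left (mul_ne_zero hM' hM')
  -- `r` is multiplicative on `𝔟`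
  have hrmul : ∀ b₁, ∀ b₂ ∈ 𝔟, r b₁ * r b₂ = r (b₁ * b₂) := by
    intro b₁ b₂ hb₂
    obtain ⟨-, hpb₂⟩ := hbp b₂ hb₂
    have h1 : r b₁ * r b₂ = ((M : ℚ)⁻¹ * (M : ℚ)⁻¹) • (jH ∘ₗ b₁ ∘ₗ ((tH ∘ₗ jH) ∘ₗ (b₂ ∘ₗ tH))) := by
      rw [hr, hr, smul_mul_smul_comm, Module.End.mul_eq_comp]
      simp only [LinearMap.comp_assoc]
    rw [h1, htj, LinearMap.sub_comp, LinearMap.smul_comp, LinearMap.smul_comp, LinearMap.id_comp,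
      ← LinearMap.comp_assoc tH b₂ p, ← Module.End.mul_eq_comp (f := p) (g := b₂), hpb₂, LinearMap.zero_comp, smul_zero,
      sub_zero, LinearMap.comp_smul, LinearMap.comp_smul, smul_smul, mul_assoc, inv_mul_cancel₀ hM', mul_one, hr,
      Module.End.mul_eq_comp]
    simp only [LinearMap.comp_assoc]
  constructor
  · -- dimensions
    rw [hmap, hmapb, ← LinearMap.range_domRestrict]
    refine LinearMap.finrank_range_of_inj fun a b hab => ?_
    apply Subtype.ext
    have h := hinj (a.1 - b.1) (Submodule.sub_mem _ a.2 b.2) (by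
      rw [map_sub]
      exact sub_eq_zero.2 hab)
    exact sub_eq_zero.1 h
  · -- not of CM type
    rintro ⟨b₁, hb₁, b₂, hb₂, hne⟩ hcm
    have hle : HZ.hodgeLie ≤ Subalgebra.toSubmodule HZ.endAlg :=
      (hodgeLie_le_endAlg_iff HZ).2 ((isOfCMType_iff_mumfordTateLieAlgebra_le_endAlg hZ).1 hcm)
    have hr₁ : r b₁ ∈ HZ.hodgeLie := by rw [hmap]; exact ⟨b₁, h𝔟 hb₁, rfl⟩
    have hr₂ : r b₂ ∈ HZ.endAlg := by
      have h : r b₂ ∈ HZ.hodgeLie := by rw [hmap]; exact ⟨b₂, h𝔟 hb₂, rfl⟩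
      exact hle h
    have hc : r b₁ * r b₂ = r b₂ * r b₁ := HZ.commute_of_mem_hodgeLie hr₁ ⟨r b₂, hr₂⟩
    rw [hrmul b₁ b₂ hb₂, hrmul b₂ b₁ hb₁] at hc
    -- `[b₁, b₂] ∈ 𝔟` and `r` kills it
    have hbr𝔥 : b₁ * b₂ - b₂ * b₁ ∈ H.hodgeLie := H.commutator_mem_hodgeLie (h𝔟 hb₁) (h𝔟 hb₂)
    have hbr : b₁ * b₂ - b₂ * b₁ ∈ 𝔟 := by
      have h := hW𝔟 _ hbr𝔥
      rwa [mul_sub, ← mul_assoc, ← mul_assoc, (hbp b₁ hb₁).2, (hbp b₂ hb₂).2, zero_mul, zero_mul, sub_zero,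
        sub_zero] at h
    exact hne (sub_eq_zero.1 (hinj _ hbr (by rw [map_sub, hc, sub_self])))

/-! ## §2 The central idempotent and the splitting `X ∼ Y ⊞ Z` -/

variable {X : AbelianVariety ℂ} {n : ℕ}

/-- **The splitting `X ∼ Y ⊞ Z` of a complex abelian variety whose Hodge Lie algebra is the sum of two commuting
three-dimensional ideals.**  Let `𝔞, 𝔟 ≤ Lie Hg(H¹X)` be ideals commuting elementwise with
`Lie Hg(H¹X) ≤ 𝔞 + 𝔟`, `dim_ℚ 𝔞 = dim_ℚ 𝔟 = 3`, neither inside `End_Hdg(H¹X)`.  Then there are a CENTRAL idempotent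
`e ∈ End⁰(X)`, `e ≠ 0, 1`, with `a e^* = a = e^* a` for `a ∈ 𝔞` and `b e^* = 0 = e^* b` for `b ∈ 𝔟`, and homomorphisms
`h : X → Y`, `i : Y → X`, `t : X → Z`, `j : Z → X` with `h ≫ i = F`, `F^* = M e^*`, `i ≫ h = M`, `j ≫ t = M`, `i ≫ t = 0`,
`j ≫ h = 0`, `h ≫ i + t ≫ j = M`, `(i, j) : Y ⊞ Z → X` an isogeny, `dim Y + dim Z = dim X`, `0 < dim Y`, `0 < dim Z`, and
**`dim_ℚ Lie Hg(H¹Y) = dim_ℚ Lie Hg(H¹Z) = 3`, `dim MT(H¹Y) = dim MT(H¹Z) = 4`, `Y`, `Z` NOT of CM type** (with the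
pull-back identities on `H¹`).  PROOF: the projector of `HodgeStructure.exists_central_projector_of_ideal_pair` is `e^*`
for a central `e` (Riemann, `exists_unop_bettiRep_eq_of_mem_endAlg`); `M e` lifts to `F ∈ End(X)` with `F² = M F`
(`exists_sq_eq_nsmul_of_idempotent`), `Y = im F`, and Poincaré's complement (`exists_complement_of_quasiRetraction`) gives
`Z`; §1 along `(t, j, e^*, 𝔟)` and `(h, i, 1 − e^*, 𝔞)`. [cite: MoonenZarhin1999LowDim, §2 and §3 (3.1), Cor. (3.7)]
[cite: MumfordAV1970, §19 Thm. 1 and proof of Cor. 2 (pp. 173–174)] [cite: DeligneMilne1982Tannakian, II §6 Thm. 6.20] -/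
theorem exists_splitting_of_ideal_pair (hX : IsSmoothProjective n X.X)
    {𝔞 𝔟 : Submodule ℚ (Module.End ℚ (bettiCohomology X.X 1))}
    (h𝔞 : haveI := BettiUniverse.finite hX 1
      𝔞 ≤ (BettiUniverse.hodge exists_isReal_hodgeModel_holds hX 1).hodgeLie)
    (h𝔟 : haveI := BettiUniverse.finite hX 1
      𝔟 ≤ (BettiUniverse.hodge exists_isReal_hodgeModel_holds hX 1).hodgeLie)
    (hI𝔞 : haveI := BettiUniverse.finite hX 1
      ∀ W ∈ (BettiUniverse.hodge exists_isReal_hodgeModel_holds hX 1).hodgeLie, ∀ a ∈ 𝔞, W * a - a * W ∈ 𝔞)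
    (hI𝔟 : haveI := BettiUniverse.finite hX 1
      ∀ W ∈ (BettiUniverse.hodge exists_isReal_hodgeModel_holds hX 1).hodgeLie, ∀ b ∈ 𝔟, W * b - b * W ∈ 𝔟)
    (hcomm : ∀ a ∈ 𝔞, ∀ b ∈ 𝔟, a * b = b * a)
    (hsum : haveI := BettiUniverse.finite hX 1
      (BettiUniverse.hodge exists_isReal_hodgeModel_holds hX 1).hodgeLie ≤ 𝔞 ⊔ 𝔟)
    (h3𝔞 : Module.finrank ℚ 𝔞 = 3) (h3𝔟 : Module.finrank ℚ 𝔟 = 3)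
    (hne𝔞 : haveI := BettiUniverse.finite hX 1
      ¬ 𝔞 ≤ Subalgebra.toSubmodule (BettiUniverse.hodge exists_isReal_hodgeModel_holds hX 1).endAlg)
    (hne𝔟 : haveI := BettiUniverse.finite hX 1
      ¬ 𝔟 ≤ Subalgebra.toSubmodule (BettiUniverse.hodge exists_isReal_hodgeModel_holds hX 1).endAlg) :
    haveI := BettiUniverse.finite hX 1
    ∃ (e : X.endAlgebra) (M : ℕ) (F : X ⟶ X) (Y Z : AbelianVariety ℂ) (h : X ⟶ Y) (i : Y ⟶ X) (t : X ⟶ Z)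
      (j : Z ⟶ X),
      e ∈ Subalgebra.center ℚ X.endAlgebra ∧ e * e = e ∧ e ≠ 0 ∧ e ≠ 1 ∧ M ≠ 0 ∧
      (∀ a ∈ 𝔞, a * MulOpposite.unop (bettiRep X e) = a ∧ MulOpposite.unop (bettiRep X e) * a = a) ∧
      (∀ b ∈ 𝔟, b * MulOpposite.unop (bettiRep X e) = 0 ∧ MulOpposite.unop (bettiRep X e) * b = 0) ∧
      AbelianVariety.endAlgebra.of X F = algebraMap ℚ X.endAlgebra (M : ℚ) * e ∧
      (bettiCohomology.map F.hom.hom.hom 1).hom = (M : ℚ) • MulOpposite.unop (bettiRep X e) ∧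
      h ≫ i = F ∧ i ≫ h = M • 𝟙 Y ∧ j ≫ t = M • 𝟙 Z ∧ i ≫ t = 0 ∧ j ≫ h = 0 ∧ h ≫ i + t ≫ j = M • 𝟙 X ∧
      IsIsogeny (biprod.desc i j) ∧ Y.dim + Z.dim = X.dim ∧ 0 < Y.dim ∧ 0 < Z.dim ∧
      ¬ IsOfCMType Y ∧ ¬ IsOfCMType Z ∧
      (haveI := BettiUniverse.finite (AbelianVariety.isSmoothProjective_holds (A := Y)) 1
       Module.finrank ℚ (BettiUniverse.hodge exists_isReal_hodgeModel_holds
          (AbelianVariety.isSmoothProjective_holds (A := Y)) 1).hodgeLie = 3) ∧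
      (haveI := BettiUniverse.finite (AbelianVariety.isSmoothProjective_holds (A := Z)) 1
       Module.finrank ℚ (BettiUniverse.hodge exists_isReal_hodgeModel_holds
          (AbelianVariety.isSmoothProjective_holds (A := Z)) 1).hodgeLie = 3) ∧
      (haveI := BettiUniverse.finite (AbelianVariety.isSmoothProjective_holds (A := Y)) 1
       (BettiUniverse.hodge exists_isReal_hodgeModel_holds (AbelianVariety.isSmoothProjective_holds (A := Y)) 1).mtRank = 4) ∧
      (haveI := BettiUniverse.finite (AbelianVariety.isSmoothProjective_holds (A := Z)) 1
       (BettiUniverse.hodge exists_isReal_hodgeModel_holds (AbelianVariety.isSmoothProjective_holds (A := Z)) 1).mtRank = 4) ∧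
      (bettiCohomology.map i.hom.hom.hom 1).hom ∘ₗ (bettiCohomology.map h.hom.hom.hom 1).hom =
        (M : ℚ) • LinearMap.id ∧
      (bettiCohomology.map h.hom.hom.hom 1).hom ∘ₗ (bettiCohomology.map i.hom.hom.hom 1).hom =
        (M : ℚ) • MulOpposite.unop (bettiRep X e) ∧
      (bettiCohomology.map j.hom.hom.hom 1).hom ∘ₗ (bettiCohomology.map t.hom.hom.hom 1).hom =
        (M : ℚ) • LinearMap.id ∧
      (bettiCohomology.map t.hom.hom.hom 1).hom ∘ₗ (bettiCohomology.map j.hom.hom.hom 1).hom =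
        (M : ℚ) • LinearMap.id - (M : ℚ) • MulOpposite.unop (bettiRep X e) := by
  have hn : X.dim = n := schemeDim_eq_holds hX
  subst hn
  haveI := BettiUniverse.finite hX 1
  have hZsp : ∀ A : AbelianVariety ℂ, IsSmoothProjective A.dim A.X := fun A => AbelianVariety.isSmoothProjective_holds
  set H := BettiUniverse.hodge exists_isReal_hodgeModel_holds hX 1 with hH
  obtain ⟨ψ⟩ := BettiUniverse.hodge_isPolarizable exists_isReal_hodgeModel_holds hX 1
  obtain ⟨p, hpA, hpp, hp0, hp1, hpc, -, hap, hbp, -, -, -, hblk, hna, hnb⟩ :=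
    exists_central_projector_of_ideal_pair H ψ (by simp) (BettiUniverse.hodge_isEffective _ hX 1) h𝔞 h𝔟 hI𝔞 hI𝔟 hcomm
      hsum h3𝔞 h3𝔟 hne𝔞 hne𝔟
  -- the rational representation and the central idempotent `e` with `e^* = p`
  have hρmul : ∀ w w' : X.endAlgebra,
      MulOpposite.unop (bettiRep X (w * w')) = MulOpposite.unop (bettiRep X w') * MulOpposite.unop (bettiRep X w) :=
    fun w w' => by rw [map_mul, MulOpposite.unop_mul]
  have hρinj : ∀ w w' : X.endAlgebra, MulOpposite.unop (bettiRep X w) = MulOpposite.unop (bettiRep X w') → w = w' :=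
    fun w w' h => bettiRep_injective (MulOpposite.unop_injective h)
  have hρA : ∀ w : X.endAlgebra, MulOpposite.unop (bettiRep X w) ∈ H.endAlg := fun w =>
    Literature.AlgebraicGeometry.ComplexMultiplication.unop_bettiRep_mem_endAlg exists_isReal_hodgeModel_holds
      hodgePQ_independent_of_hodgeModel_holds w
  obtain ⟨e, he⟩ := exists_unop_bettiRep_eq_of_mem_endAlg hX hpA
  have hec : e ∈ Subalgebra.center ℚ X.endAlgebra := by
    rw [Subalgebra.mem_center_iff]
    intro w
    apply hρinj
    rw [hρmul, hρmul, he]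
    exact (hpc _ (hρA w)).symm
  have hee : e * e = e := hρinj _ _ (by rw [hρmul, he, hpp])
  have he0 : e ≠ 0 := fun h => hp0 (by rw [← he, h, map_zero, MulOpposite.unop_zero])
  have he1 : e ≠ 1 := fun h => hp1 (by rw [← he, h, map_one, MulOpposite.unop_one])
  -- `F = M e` and the splitting
  obtain ⟨M, F, hM, hFe, hFrep, hFF⟩ := exists_sq_eq_nsmul_of_idempotent e hee
  have hM' : (M : ℚ) ≠ 0 := Nat.cast_ne_zero.mpr hM
  have hcomp : ∀ {A B C : AbelianVariety ℂ} (f : A ⟶ B) (g : B ⟶ C),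
      (bettiCohomology.map (f ≫ g).hom.hom.hom 1).hom =
        (bettiCohomology.map f.hom.hom.hom 1).hom ∘ₗ (bettiCohomology.map g.hom.hom.hom 1).hom := by
    intro A B C f g
    rw [bettiCohomology_map_comp_hom, ModuleCat.hom_comp]
  have hnsid : ∀ (A : AbelianVariety ℂ) (N : ℕ),
      (bettiCohomology.map (N • 𝟙 A : A ⟶ A).hom.hom.hom 1).hom = (N : ℚ) • (1 : Module.End ℚ _) := by
    intro A N
    rw [bettiCohomology_map_nsmul_id_one, ModuleCat.hom_nsmul, ModuleCat.hom_id, Nat.cast_smul_eq_nsmul,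
      Module.End.one_eq_id]
  have hzero : ∀ (A B : AbelianVariety ℂ), (bettiCohomology.map (0 : A ⟶ B).hom.hom.hom 1).hom = 0 := by
    intro A B
    rw [bettiCohomology_map_zero_one, ModuleCat.hom_zero]
  set Y := AbelianVariety.image F with hY
  set i : Y ⟶ X := AbelianVariety.imageι F with hidef
  set h : X ⟶ Y := AbelianVariety.toImage F with hhdef
  have hhi : h ≫ i = F := AbelianVariety.toImage_imageι F
  have hih : i ≫ h = M • 𝟙 Y := by
    haveI := AbelianVariety.mono_of_isClosedImmersion_toSchemeHom (AbelianVariety.imageι F)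
    haveI := AbelianVariety.epi_of_surjective_toSchemeHom (AbelianVariety.toImage F)
    rw [← cancel_mono (AbelianVariety.imageι F), ← cancel_epi (AbelianVariety.toImage F)]
    change h ≫ (i ≫ h) ≫ i = h ≫ (M • 𝟙 Y) ≫ i
    calc h ≫ (i ≫ h) ≫ i = (h ≫ i) ≫ (h ≫ i) := by simp only [Category.assoc]
      _ = F ≫ F := by rw [hhi]
      _ = M • F := hFF
      _ = h ≫ (M • 𝟙 Y) ≫ i := by rw [Preadditive.nsmul_comp, Category.id_comp, Preadditive.comp_nsmul, hhi]
  obtain ⟨Z, j, t, -, hiso, hjh, hdimYZ, hld, hdl⟩ := AbelianVariety.exists_complement_of_quasiRetraction i h hM hih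
  have hsum' : h ≫ i + t ≫ j = M • 𝟙 X := by rw [← biprod.lift_desc]; exact hld
  have hit : i ≫ t = 0 := by
    have h' := congrArg (fun f => biprod.inl ≫ f ≫ biprod.snd) hdl
    simpa only [biprod.inl_desc_assoc, Category.assoc, biprod.lift_snd, Preadditive.comp_nsmul, Category.comp_id,
      Category.id_comp, Preadditive.nsmul_comp, biprod.inl_snd, smul_zero] using h'
  have hjt : j ≫ t = M • 𝟙 Z := by
    have h' := congrArg (fun f => biprod.inr ≫ f ≫ biprod.snd) hdl
    simpa only [biprod.inr_desc_assoc, Category.assoc, biprod.lift_snd, Preadditive.comp_nsmul, Category.comp_id,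
      Category.id_comp, Preadditive.nsmul_comp, biprod.inr_snd] using h'
  -- the pull-backs
  set iS := (bettiCohomology.map i.hom.hom.hom 1).hom with hiS
  set hS := (bettiCohomology.map h.hom.hom.hom 1).hom with hhS
  set jS := (bettiCohomology.map j.hom.hom.hom 1).hom with hjS
  set tS := (bettiCohomology.map t.hom.hom.hom 1).hom with htS
  have h1 : iS ∘ₗ hS = (M : ℚ) • LinearMap.id := by rw [hiS, hhS, ← hcomp, hih, hnsid, Module.End.one_eq_id]
  have h2 : hS ∘ₗ iS = (M : ℚ) • p := by rw [hhS, hiS, ← hcomp, hhi, hFrep, he]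
  have h3 : jS ∘ₗ tS = (M : ℚ) • LinearMap.id := by rw [hjS, htS, ← hcomp, hjt, hnsid, Module.End.one_eq_id]
  have h5 : iS ∘ₗ tS = 0 := by rw [hiS, htS, ← hcomp, hit, hzero]
  have h6 : jS ∘ₗ hS = 0 := by rw [hjS, hhS, ← hcomp, hjh, hzero]
  have h4 : tS ∘ₗ jS = (M : ℚ) • LinearMap.id - (M : ℚ) • p := by
    have h' : (bettiCohomology.map (h ≫ i + t ≫ j).hom.hom.hom 1).hom = (M : ℚ) • (1 : Module.End ℚ _) := by
      rw [hsum', hnsid]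
    rw [bettiCohomology_map_add_one, ModuleCat.hom_add, hcomp, hcomp, ← hhS, ← hiS, ← htS, ← hjS, h2,
      Module.End.one_eq_id] at h'
    rw [← h']
    abel
  have h2' : hS ∘ₗ iS = (M : ℚ) • LinearMap.id - (M : ℚ) • (1 - p) := by rw [h2, smul_sub, Module.End.one_eq_id]; abel
  -- §1 for `Z` along `(t, j, p, 𝔟)` and for `Y` along `(h, i, 1 − p, 𝔞)`
  haveI := BettiUniverse.finite (hZsp Z) 1
  haveI := BettiUniverse.finite (hZsp Y) 1
  have hW𝔟 : ∀ W ∈ H.hodgeLie, W - p * W ∈ 𝔟 := fun W hW => (hblk W hW).2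
  have hW𝔞 : ∀ W ∈ H.hodgeLie, W - (1 - p) * W ∈ 𝔞 := fun W hW => by
    rw [sub_mul, one_mul, sub_sub_cancel]; exact (hblk W hW).1
  have hap' : ∀ a ∈ 𝔞, a * (1 - p) = 0 ∧ (1 - p) * a = 0 := fun a ha => by
    constructor
    · rw [mul_sub, mul_one, (hap a ha).1, sub_self]
    · rw [sub_mul, one_mul, (hap a ha).2, sub_self]
  obtain ⟨hdimZ, hZcm⟩ := finrank_hodgeLie_hodge_one_eq_of_block_ideal hX (hZsp Z) t j hM h3 h4 h𝔟 hW𝔟 hbp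
  obtain ⟨hdimY, hYcm⟩ := finrank_hodgeLie_hodge_one_eq_of_block_ideal hX (hZsp Y) h i hM h1 h2' h𝔞 hW𝔞 hap'
  -- `0 < dim Y`, `0 < dim Z`
  have hY0 : 0 < Y.dim := by
    by_contra hY0
    have hfin : Module.finrank ℚ (bettiCohomology Y.X 1) = 0 := by rw [finrank_bettiCohomology_one]; omega
    haveI : Subsingleton (bettiCohomology Y.X 1) := Module.finrank_zero_iff.1 hfin
    have hiS0 : iS = 0 := by ext v; exact Subsingleton.elim _ _
    apply hp0
    have h := h2
    rw [hiS0, LinearMap.comp_zero] at h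
    exact ((smul_eq_zero.1 h.symm).resolve_left hM')
  have hZ0 : 0 < Z.dim := by
    by_contra hZ0
    have hfin : Module.finrank ℚ (bettiCohomology Z.X 1) = 0 := by rw [finrank_bettiCohomology_one]; omega
    haveI : Subsingleton (bettiCohomology Z.X 1) := Module.finrank_zero_iff.1 hfin
    have hjS0 : jS = 0 := by ext v; exact Subsingleton.elim _ _
    apply hp1
    have h := h4
    rw [hjS0, LinearMap.comp_zero, eq_comm, sub_eq_zero] at h
    have h' := smul_right_injective (Module.End ℚ (bettiCohomology X.X 1)) hM' h
    rw [Module.End.one_eq_id]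
    exact h'.symm
  refine ⟨e, M, F, Y, Z, h, i, t, j, hec, hee, he0, he1, hM, fun a ha => ?_, fun b hb => ?_, hFe, by rw [hFrep, he], hhi,
    hih, hjt, hit, hjh, hsum', hiso, hdimYZ, hY0, hZ0, hYcm hna, hZcm hnb, by rw [hdimY, h3𝔞], by rw [hdimZ, h3𝔟], ?_, ?_,
    h1, by rw [h2, he], h3, by rw [h4, he]⟩
  · rw [he]; exact hap a ha
  · rw [he]; exact hbp b hb
  · rw [mtRank_hodge_one_eq_finrank_hodgeLie_add_one (hZsp Y) hY0, hdimY, h3𝔞]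
  · rw [mtRank_hodge_one_eq_finrank_hodgeLie_add_one (hZsp Z) hZ0, hdimZ, h3𝔟]

end Summit.HodgeConjecture.CorCM

end
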